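import Summits.CriticalPhenomena.PercolationContinuityZ3.Theorems.PercNearOneGluingNoHeavyQuantGatedShiftDECHolds
import Summits.CriticalPhenomena.PercolationContinuityZ3.Theorems.PercNearOneGluingNoHeavyQuantSDECPoint
import HarnessLib

/-!
# QUANT lane R8, T-DEC: SPINE LAWS ARE SDEC — the reached-relay count of every CATERPILLAR forest (a chain of gates, each carrying
# any number of sure relays and at most one further gate) is gate-stable DEC, hence DEC at every layer and FAR at every dominant layer,
# UNCONDITIONALLY (first infinite family of `LawDec.TreeBuiltDEC` / `Quant.TreeDEC` beyond single hubs, from Conjecture R)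

builds on p205010 (kernel theorem, internal audit signed; external expert review pending)

Support file (`--supports stmt-CriticalPhenomena-4575`), QUANT lane typer seat prim-quant-stmt (gen 26), rung R8 of
`run/shared/lean/prim/quant/LADDER.md`.  One inductive predicate, theorems with standard axioms, no sorries.  Uses Conjecture R as a theorem
(`LawDec.gatedShift_sdecUpTo`, `…QuantGatedShiftDECHolds`), `sdec_gate`, `shift_laws`, `gate_laws`, `decAt_of_sdec`, `tail_ge_of_decAt`.

THE FAMILY.  `LawDec.SpineBuilt x M μ`: the laws obtained from the empty law `δ₀` by repeatedly (i) adding `k` sure relays at the root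
and hanging everything under a new gate `q ∈ (0,1]` — `μ ↦ gate_q(μ(· − k))`, floor `x ↦ q·x` — and (ii) lowering the floor.  These are
exactly the reached-relay counts of SPINES / CATERPILLARS: a root gate `q₁` with `k₁` relays and one child gate `q₂` with `k₂` relays and one
child gate `q₃` …, at any floor at most the least marginal.  (General trees also CONVOLVE independent subtrees at a vertex — that step is
`SDECConvClosed`, open.)
THE THEOREM (`spineBuilt_sdec`).  Every spine law is a top-affordable probability law that is SDEC at its floor: step (i) is Conjecture R
(`gatedShift_sdecUpTo` with `Q = 1`, then `sdec_gate`), step (ii) is `sdec_mono`.  COROLLARIES: DEC(j′) at EVERY layer (`decAt_of_spineBuilt`,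
via `decAt_of_sdec`) — the conclusion of `Quant.TreeDEC` for caterpillar forests — and the FAR TREE ROW at every dominant layer
(`spine_tail_ge`: `2j′ < mean ⟹ x ≤ P(N ≥ j′+1)`, via `tail_ge_of_decAt`).  HONEST STATUS: `TreeBuiltDEC`, `TreeDEC`, `FarTreeRow`,
`SDECConvClosed` remain OPEN for branching trees.

[this work]; SDEC / TreeBuilt: prim-quant-census-2 g53; Conjecture R: typer g25 (statement), typer g26 (proof) (this lane).  The gluing rows
served [cite: KozmaNitzan2024, Conjecture 3 (p. 15)]; product measure [cite: Grimmett1999, §1.3 p. 10].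
-/

noncomputable section

namespace Summit.CriticalPhenomena.PercolationContinuityZ3.Theorems

namespace Quant

open Finset

namespace LawDec

/-! ### Spine laws -/

/-- **Spine-built count laws** (caterpillar forests): from `δ₀` (at a floor `0 < x < 1`) by "add `k` sure relays at the root and hang under a
gate `0 < q ≤ 1`" (`μ ↦ gate (μ(· − k)) q`, floor `↦ q·x`, top `↦ k + M`) and floor lowering. [this work] -/
inductive SpineBuilt : ℝ → ℕ → (ℕ → ℝ) → Prop
  | nil (x : ℝ) (hx0 : 0 < x) (hx1 : x < 1) : SpineBuilt x 0 (fun h => if h = 0 then (1 : ℝ) else 0)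
  | hang {x : ℝ} {M : ℕ} {μ : ℕ → ℝ} (k : ℕ) (q : ℝ) (hq0 : 0 < q) (hq1 : q ≤ 1) (h : SpineBuilt x M μ) :
      SpineBuilt (q * x) (k + M) (gate (fun t => if k ≤ t then μ (t - k) else 0) q)
  | mono {x x' : ℝ} {M : ℕ} {μ : ℕ → ℝ} (h : SpineBuilt x M μ) (hx'0 : 0 < x') (hxx : x' ≤ x) : SpineBuilt x' M μ

/-- **SPINE LAWS ARE SDEC.**  Every spine law is a probability law on `{0..M}` at a floor in `(0,1)`, top-affordable, and SDEC there
(the relay step is Conjecture R, `gatedShift_sdecUpTo`; the gate is `sdec_gate`; the floor `sdec_mono`). [this work] -/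
theorem spineBuilt_sdec {x : ℝ} {M : ℕ} {μ : ℕ → ℝ} (h : SpineBuilt x M μ) :
    0 < x ∧ x < 1 ∧ (∀ t, 0 ≤ μ t) ∧ (∀ t, M < t → μ t = 0) ∧ (∑ t ∈ Finset.range (M + 1), μ t = 1) ∧
      x * (M : ℝ) ≤ (∑ t ∈ Finset.range (M + 1), (t : ℝ) * μ t) ∧ SDEC x M μ := by
  induction h with
  | nil x₀ hx0 hx1 =>
    refine ⟨hx0, hx1, fun t => ?_, fun t ht => if_neg (by omega), by simp, by simp, ?_⟩
    · beta_reduce; split_ifs <;> norm_num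
    · intro q _ _ j' hj; omega
  | @hang x₀ M₀ μ₀ k q hq0 hq1 h ih =>
    obtain ⟨hx0, hx1, n0, zM, s1, ta, sd⟩ := ih
    obtain ⟨sh0, shM, sh1, shmean⟩ := shift_laws k M₀ μ₀ n0 zM s1
    -- the shifted law is SDEC at `x₀` (Conjecture R with `Q = 1`; `k = 0` is the law itself)
    have shS : SDEC x₀ (k + M₀) (fun t => if k ≤ t then μ₀ (t - k) else 0) := by
      rcases Nat.eq_zero_or_pos k with hk | hk
      · subst hk
        have e : (fun t => if 0 ≤ t then μ₀ (t - 0) else 0) = μ₀ := funext fun t => by simp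
        rw [e, Nat.zero_add]; exact sd
      · have := gatedShift_sdecUpTo x₀ 1 k M₀ μ₀ hx0 hx1.le le_rfl (by linarith) hk n0 zM s1 ta
          ((sdecUpTo_one_iff x₀ M₀ μ₀).2 sd)
        exact (sdecUpTo_one_iff x₀ (k + M₀) _).1 this
    obtain ⟨g0, gM, g1⟩ := gate_laws (k + M₀) _ q hq0.le hq1 sh0 shM sh1
    refine ⟨mul_pos hq0 hx0, by nlinarith, g0, gM, g1, ?_, sdec_gate shS q hq0 hq1⟩
    rw [sum_mul_gate, shmean]
    have h1 : x₀ * ((k + M₀ : ℕ) : ℝ) ≤ (∑ t ∈ Finset.range (M₀ + 1), (t : ℝ) * μ₀ t) + k := by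
      push_cast
      have : x₀ * (k : ℝ) ≤ k := by nlinarith [(Nat.cast_nonneg k : (0 : ℝ) ≤ k)]
      linarith
    have h2 : q * x₀ * ((k + M₀ : ℕ) : ℝ) ≤ q * ((∑ t ∈ Finset.range (M₀ + 1), (t : ℝ) * μ₀ t) + k) := by
      have := mul_le_mul_of_nonneg_left h1 hq0.le
      linarith [this]
    exact h2
  | @mono x₀ x' M₀ μ₀ h hx'0 hxx ih =>
    obtain ⟨hx0, hx1, n0, zM, s1, ta, sd⟩ := ih
    refine ⟨hx'0, lt_of_le_of_lt hxx hx1, n0, zM, s1, ?_, sdec_mono sd hxx hx1⟩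
    have : x' * (M₀ : ℝ) ≤ x₀ * (M₀ : ℝ) := mul_le_mul_of_nonneg_right hxx (Nat.cast_nonneg _)
    linarith

/-- **every spine law is DEC(j′) at EVERY layer** — the conclusion of `Quant.TreeDEC` for caterpillar forests, unconditionally. [this work] -/
theorem decAt_of_spineBuilt {x : ℝ} {M : ℕ} {μ : ℕ → ℝ} (h : SpineBuilt x M μ) (j' : ℕ) : DECAt x j' M μ := by
  obtain ⟨hx0, hx1, n0, zM, s1, ta, sd⟩ := spineBuilt_sdec h
  exact decAt_of_sdec sd hx0 hx1 n0 zM s1 ta j'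

/-- **the FAR tree row for spines**: at every dominant layer (`2j′ <` mean), `x ≤ P(N ≥ j′ + 1) = Σ_{h > j′} μ h` (`tail_ge_of_decAt`). [this work] -/
theorem spine_tail_ge {x : ℝ} {M : ℕ} {μ : ℕ → ℝ} (h : SpineBuilt x M μ) (j' : ℕ)
    (hdom : (2 * j' : ℝ) < ∑ t ∈ Finset.range (M + 1), (t : ℝ) * μ t) :
    x ≤ ∑ t ∈ Finset.Ico (j' + 1) (M + 1), μ t := by
  obtain ⟨_, hx1, _, _, _, _, _⟩ := spineBuilt_sdec h
  exact tail_ge_of_decAt x j' M μ hx1.le (decAt_of_spineBuilt h j') hdom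

/-- spine laws are tree-built (so `spineBuilt_sdec` is the caterpillar case of `TreeBuiltDEC`). [this work] -/
theorem treeBuilt_of_spineBuilt {x : ℝ} {M : ℕ} {μ : ℕ → ℝ} (h : SpineBuilt x M μ) : TreeBuilt x M μ := by
  induction h with
  | nil x₀ hx0 hx1 => exact TreeBuilt.nil x₀ hx0 hx1
  | @hang x₀ M₀ μ₀ k q hq0 hq1 h ih =>
    obtain ⟨hx0, hx1, _, zM, _, _, _⟩ := spineBuilt_sdec h
    have e : (fun t => if k ≤ t then μ₀ (t - k) else 0) = lconv k M₀ (fun i => if i = k then (1 : ℝ) else 0) μ₀ :=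
      (funext fun t => lconv_point_left k M₀ μ₀ zM t).symm
    rw [e]
    refine TreeBuilt.gate q hq0 hq1 (TreeBuilt.conv ?_ ih)
    -- `δ_k` is tree-built: `k` relays convolved (induction on `k`)
    clear e ih h
    induction k with
    | zero =>
      have e0 : (fun i : ℕ => if i = 0 then (1 : ℝ) else 0) = fun h => if h = 0 then (1 : ℝ) else 0 := rfl
      exact TreeBuilt.nil x₀ hx0 hx1
    | succ n ihn =>
      have e1 : (fun i : ℕ => if i = n + 1 then (1 : ℝ) else 0)
          = lconv n 1 (fun i => if i = n then (1 : ℝ) else 0) (fun i => if i = 1 then (1 : ℝ) else 0) := by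
        funext t
        rw [lconv_point_left n 1 (fun i => if i = 1 then (1 : ℝ) else 0) (fun h hh => if_neg (by omega)) t]
        by_cases ht : n ≤ t
        · rw [if_pos ht]
          by_cases h2 : t = n + 1
          · rw [if_pos h2, if_pos (by omega)]
          · rw [if_neg h2, if_neg (by omega)]
        · rw [if_neg ht, if_neg (by omega)]
      rw [e1]
      exact TreeBuilt.conv ihn (TreeBuilt.relay x₀ hx0 hx1)
  | @mono x₀ x' M₀ μ₀ h hx'0 hxx ih => exact TreeBuilt.mono ih hx'0 hxx

end LawDec

end Quant

end Summit.CriticalPhenomena.PercolationContinuityZ3.Theorems
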